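import Mathlib.LinearAlgebra.Dimension.Finrank
import Mathlib.LinearAlgebra.FiniteDimensional.Defs
import Mathlib.LinearAlgebra.FiniteDimensional.Lemmas
import Summits.BirchSwinnertonDyer.BirchSwinnertonDyer.Theses.KolyvaginRoadThree
import HarnessLib

/-!
# Route `KolyvaginRoadThree`, deciding crux `ZhangSharpFrameAtThreeHL` (item stmt-BirchSwinnertonDyer-19574):
# the RANK-LOWERING input (A1) of W. Zhang's induction, WITH its (9.1)–(9.2) eigen-bookkeeping, DERIVED as pure
# linear algebra from the three printed local–global inputs at ONE admissible prime
# (cell `bsd-stepL`, seat `bsd-stepL-koly3a` g0, ACCEL-LIST (9); `--supports stmt-BirchSwinnertonDyer-19574`, helper)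

HONEST FRAMING. Nothing about elliptic curves, Heegner points or `p = 3` is asserted; no definition, no named fact,
no `sorry`; nothing is booked. The tree's kernel form of W. Zhang's induction (Camb. J. Math. 2 (2014) §9,
`Theorems/KolyvaginRoadThreeZhangInduction.lean`, zhang3-p1 p446019 ∕ p446227) consumes SIX hypothesis shapes; the
first, (A1) RANK LOWERING — «a non-zero class `c ∈ Sel_n^μ` is killed by raising the level at ONE new admissible
prime `q`, the `μ`-part dropping by exactly one dimension INSIDE `Sel_n^μ` and the `−μ`-part unchanged AS A
SUBSPACE» — is itself a composite of three printed statements and one piece of linear algebra (referee g30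
pre-check, remarks R2 «a `p = 3` datum-provider must prove the subspace form» and R4 «where `p ≥ 5` actually sits»).
This file performs that decomposition in the kernel, uniformly in the coefficient field `F` (`char F ≠ 2`), for
ARBITRARY data: an ambient space `H` (Zhang: `H¹(K, V)`), an involution-eigenspace pair `eig ± ⊆ H` cut out by a
linear operator `τ` (complex conjugation, Gross 1991 (5.1)), sign-free level spaces `S n ⊆ H` (Zhang's
`Sel_{𝔭_n,0}(A_n/K)`), `Sel n μ := eig μ ⊓ S n`, and for every admissible prime `q` a localisation
`loc q : H →ₗ L q` (Zhang: `loc_q : H¹(K,V) → H¹(K_q,V)`), a line `Lfin q ≤ L q` (the finite ∕ unramified part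
`H¹_fin(K_q, V)`) and a sign `ε q` (the sign of `Frob_q` on `V`). INPUTS (hypothesis shapes, each a printed statement
read at the page by referee g30 ∕ koly MEMO-v1–v2 at `p = 3`):

* (L) THE FINITE PART IS A LINE receiving the unramified classes: `dim Lfin q ≤ 1` and `loc q (S n) ⊆ Lfin q` for
  `q ∉ n` [Bertolini–Darmon 2005 Lemma 2.6 (`p ∤ q² − 1`); at `p = 3` for UNIPOTENT-admissible `q`: koly MEMO-v1 U1 =
  tree `UAdm.range_sub_one_eq_ker` ∕ `finrank_ker_sub_one_eq_one` (`H¹_fin(K_q,E[3]) = E[3]/ℓ` a line)];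
* (P1) KERNEL DESCRIPTION [W. Zhang 2014 Prop. 5.4, p. 225: if `loc_q` is non-trivial on `Sel(A_n)` then
  `Sel(A_{nq}) = Ker(loc_q : Sel(A_n) → H¹_fin(K_q))` — the Poitou–Tate line dichotomy at an admissible prime,
  Gross–Parson ∕ BD05; no parity-of-level hypothesis];
* (P2) ČEBOTAREV [W. Zhang 2014 Lemma 7.3 (the ONLY `p ≥ 5` of the §9 chain, R4) ∕ BD05 Thm. 3.2: a non-zero
  `μ`-eigenclass is detected by `loc_q` at some admissible `q ∉ n` (of sign `μ`); at `p = 3`: koly MEMO-v2 U3, the sign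
  rule `νδ = +1` with `isUnit_one_add`];
* (P3) τ-EQUIVARIANCE WITH A SCALAR LOCAL SIGN [«the process is compatible with the action of complex conjugation»,
  W. Zhang 2014 p. 241 (9.1)–(9.2); at an admissible `q` INERT in `K`, `τ|_{K_q} = Frob_q` acts on the line
  `H¹_fin(K_q,V) = V/(Frob_q − 1)V` by the scalar `ε_q = ±1`]: `loc q (τ x) = ε_q · loc q x`.

OUTPUT (`rankLowering_of_lineDichotomy`): EXACTLY the engine's hypothesis `hA1` for `Sel`, including the codimension-one
count (rank–nullity on the line) and the SUBSPACE equality `Sel_{nq}^{−μ} = Sel_n^{−μ}` (R2) — the latter because the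
sign of the detecting prime is FORCED to be `μ` (`sign_eq_of_loc_ne_zero`), whence `loc_q` kills the whole
`−μ`-eigenspace (`loc_eq_zero_of_mem_eig_of_sign_ne`, `2 ≠ 0`). For 19574 this is the (A1)-conjunct of koly's v2 stub
`stub_levelRaisingAtThree` (HOME koly/skel/Lines-method2-19574.lean) reduced to (L)+(P1)+(P2)+(P3) on the canonical spaces
`SelQ`; the companion file `KolyvaginRoadThreeZhangInductionRefined.lean` feeds it to the engine. PARTITION: O2@3 (B10) ×
A1 × crux 19574 — none (composition-engine refinement; types nothing, closes nothing).

References: [cite: WZhang2014, Prop. 5.4 (p. 225), Lemma 7.3 (p. 232), §9 (9.1)–(9.2) (p. 241)]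
[cite: BertoliniDarmon2005, Lemma 2.6, Thm. 3.2] [cite: GrossLMS1991, §5 (5.1)].
-/

namespace Summit.BirchSwinnertonDyer.Rank1Residual.X11b.Three.Koly.ZhangInduction

open Module

variable {F : Type*} [Field F] {H : Type*} [AddCommGroup H] [Module F H]
  {Q : Type*} [DecidableEq Q] {L : Q → Type*} [∀ q, AddCommGroup (L q)] [∀ q, Module F (L q)]

/-! ## The sign of a detecting prime is forced (Zhang (9.2)) -/

omit [DecidableEq Q] in
/-- **`loc_q` kills the eigenspace of the opposite sign.** If `τ` acts on `x` by the sign `μ` (`x ∈ eig μ`), `loc q`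
is `τ`-equivariant with `τ` acting on the target by the scalar sign `ε q`, and `ε q ≠ μ`, then `loc q x = 0`
(`loc q x = −loc q x` and `2 ≠ 0`). This is W. Zhang's (9.2) «`Sel^{−μ}` unchanged»: at an admissible prime of sign
`μ`, every `−μ`-eigenclass is locally trivial. [cite: WZhang2014, §9 (9.2), p. 241] -/
theorem loc_eq_zero_of_mem_eig_of_sign_ne
    (eig : Bool → Submodule F H) (τ : H →ₗ[F] H) {q : Q} (loc : H →ₗ[F] L q) (εq : Bool)
    (h2 : (2 : F) ≠ 0)
    (heig : ∀ (μ : Bool) (x : H), x ∈ eig μ → τ x = if μ then x else -x)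
    (hequiv : ∀ x : H, loc (τ x) = if εq then loc x else -loc x)
    {μ : Bool} {x : H} (hx : x ∈ eig μ) (hne : εq ≠ μ) : loc x = 0 := by
  have h1 := hequiv x
  rw [heig μ x hx] at h1
  -- in either case `loc x = - loc x`
  have hself : loc x = -loc x := by
    cases μ <;> cases εq
    · exact absurd rfl hne
    · simpa [eq_comm] using h1
    · simpa using h1
    · exact absurd rfl hne
  have h2x : (2 : F) • loc x = 0 := by
    rw [two_smul]
    nth_rewrite 2 [hself]
    exact add_neg_cancel (loc x)
  rcases smul_eq_zero.mp h2x with h | h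
  · exact absurd h h2
  · exact h

omit [DecidableEq Q] in
/-- **The sign of a detecting prime is forced**: if `x ∈ eig μ` and `loc q x ≠ 0` then `ε q = μ` (contrapositive of
`loc_eq_zero_of_mem_eig_of_sign_ne`). BD05 Thm. 3.2 ∕ Zhang Lemma 7.3 choose `q` with this sign; here the sign is READ
OFF the non-vanishing. [cite: WZhang2014, Lemma 7.3 and (9.2)] -/
theorem sign_eq_of_loc_ne_zero
    (eig : Bool → Submodule F H) (τ : H →ₗ[F] H) {q : Q} (loc : H →ₗ[F] L q) (εq : Bool)
    (h2 : (2 : F) ≠ 0)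
    (heig : ∀ (μ : Bool) (x : H), x ∈ eig μ → τ x = if μ then x else -x)
    (hequiv : ∀ x : H, loc (τ x) = if εq then loc x else -loc x)
    {μ : Bool} {x : H} (hx : x ∈ eig μ) (hne0 : loc x ≠ 0) : εq = μ := by
  by_contra hne
  exact hne0 (loc_eq_zero_of_mem_eig_of_sign_ne eig τ loc εq h2 heig hequiv hx hne)

/-! ## Codimension one: rank–nullity against a line -/

/-- **Cutting a finite-dimensional subspace by the kernel of a map that is non-zero on it and lands in a line drops
the dimension by exactly one**: `dim (T ⊓ ker f) + 1 = dim T` when `f(T) ⊆ Λ`, `dim Λ ≤ 1` and `f c ≠ 0` for some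
`c ∈ T`. (Zhang Prop. 5.4: «`dim Sel(A') = dim Sel(A) − 1`» from the surjection onto the line `H¹_fin(K_q, V)`.)
[folklore] -/
theorem finrank_inf_ker_add_one_of_line {L' : Type*} [AddCommGroup L'] [Module F L']
    (T : Submodule F H) [FiniteDimensional F T] (f : H →ₗ[F] L') (Λ : Submodule F L') [FiniteDimensional F Λ]
    (hΛ : finrank F Λ ≤ 1) (hmem : ∀ x ∈ T, f x ∈ Λ) (hc : ∃ c ∈ T, f c ≠ 0) :
    finrank F ↥(T ⊓ LinearMap.ker f) + 1 = finrank F T := by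
  -- the restriction `g = f|_T : T → L'`
  set g : T →ₗ[F] L' := f.comp T.subtype with hg
  have hrange : LinearMap.range g ≤ Λ := by
    rintro y ⟨x, rfl⟩
    exact hmem x x.2
  haveI : FiniteDimensional F (LinearMap.range g) := Submodule.finiteDimensional_of_le hrange
  -- `dim range g = 1`
  have hle : finrank F (LinearMap.range g) ≤ 1 := (Submodule.finrank_mono hrange).trans hΛ
  have hpos : finrank F (LinearMap.range g) ≠ 0 := by
    intro h0
    obtain ⟨c, hcT, hc0⟩ := hc
    have hbot : LinearMap.range g = ⊥ := Submodule.finrank_eq_zero.mp h0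
    have : g ⟨c, hcT⟩ ∈ LinearMap.range g := LinearMap.mem_range_self g _
    rw [hbot, Submodule.mem_bot] at this
    exact hc0 this
  have hrk := LinearMap.finrank_range_add_finrank_ker g
  -- `ker g`, as a subspace of `H`, is `T ⊓ ker f`
  have hker : Submodule.map T.subtype (LinearMap.ker g) = T ⊓ LinearMap.ker f := by
    rw [hg, LinearMap.ker_comp, Submodule.map_comap_subtype]
  have hkerrk : finrank F ↥(T ⊓ LinearMap.ker f) = finrank F (LinearMap.ker g) := by
    rw [← hker, Submodule.finrank_map_subtype_eq]
  omega

/-! ## (P1) itself from Poitou–Tate ISOTROPY and the transversality of the two local lines -/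

/-- **Zhang's Prop. 5.4 (kernel description) from global isotropy.** Let `R` be the Selmer space RELAXED at `q`
(conditions away from `q` only), `f = loc_q`, and `Λ`, `Ω` the finite and the ordinary local lines at `q`, with the
level-`n` space `T = R ⊓ f⁻¹(Λ)` and the raised space `T' = R ⊓ f⁻¹(Ω)` (definitional for the canonical spaces).
If (Iso) the image `f(R)` is at most a line — any two images are proportional — [Poitou–Tate: the image of the global relaxed Selmer group in
`H¹(K_q, V)` is isotropic for the non-degenerate local Tate pairing on the plane `H¹(K_q, V)`; Milne ADT I.4.10 ∕
Gross–Parson ∕ BD05], (Trans) `Λ ⊓ Ω = 0` [BD05 Lemma 2.6; at `p = 3` koly U4: `H¹_fin ⊕ H¹_ord`] and `f` is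
non-trivial on `T`, then `T' = T ⊓ ker f`: the image `f(R)` is the line `Λ` (it contains `f c ≠ 0` and has
dimension ≤ 1), so a class of `T'` localises into `Ω ⊓ Λ = 0`. [cite: WZhang2014, Prop. 5.4 (p. 225)]
[cite: BertoliniDarmon2005, Lemma 2.6] -/
theorem kernelDescription_of_isotropy {L' : Type*} [AddCommGroup L'] [Module F L']
    (R : Submodule F H) (f : H →ₗ[F] L') (Λ Ω : Submodule F L')
    -- (Iso) the image of the relaxed space is at most a line: any two images are proportional
    (hiso : ∀ x ∈ R, ∀ y ∈ R, f y ≠ 0 → ∃ a : F, f x = a • f y)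
    -- (Trans) the finite and ordinary lines are transverse
    (htrans : Λ ⊓ Ω = ⊥)
    (hc : ∃ c ∈ R ⊓ Submodule.comap f Λ, f c ≠ 0) :
    R ⊓ Submodule.comap f Ω = (R ⊓ Submodule.comap f Λ) ⊓ LinearMap.ker f := by
  obtain ⟨c, hcmem, hc0⟩ := hc
  obtain ⟨hcR, hcΛ⟩ := Submodule.mem_inf.mp hcmem
  rw [Submodule.mem_comap] at hcΛ
  refine le_antisymm (fun x hx ↦ ?_) (fun x hx ↦ ?_)
  · obtain ⟨hxR, hxΩ⟩ := Submodule.mem_inf.mp hx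
    rw [Submodule.mem_comap] at hxΩ
    -- `f x` is a multiple of `f c ∈ Λ`, and lies in `Ω`: it is `0`
    obtain ⟨a, ha⟩ := hiso x hxR c hcR hc0
    have hxΛ : f x ∈ Λ := ha ▸ Λ.smul_mem a hcΛ
    have hx0 : f x = 0 := by
      have : f x ∈ Λ ⊓ Ω := Submodule.mem_inf.mpr ⟨hxΛ, hxΩ⟩
      rw [htrans, Submodule.mem_bot] at this
      exact this
    exact Submodule.mem_inf.mpr
      ⟨Submodule.mem_inf.mpr ⟨hxR, by rw [Submodule.mem_comap, hx0]; exact Λ.zero_mem⟩, LinearMap.mem_ker.mpr hx0⟩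
  · obtain ⟨hxT, hxker⟩ := Submodule.mem_inf.mp hx
    have hx0 : f x = 0 := LinearMap.mem_ker.mp hxker
    exact Submodule.mem_inf.mpr
      ⟨(Submodule.mem_inf.mp hxT).1, by rw [Submodule.mem_comap, hx0]; exact Ω.zero_mem⟩

/-! ## (A1) from (L) + (P1) + (P2) + (P3) -/

/-- **RANK LOWERING (the engine's hypothesis (A1), with the (9.1)–(9.2) eigen-bookkeeping in subspace form) from the
line dichotomy, Čebotarev and τ-equivariance.** Data: sign-free level spaces `S n ⊆ H`, eigenspaces `eig μ` of a linear
operator `τ` (`τ x = ± x` on `eig ±`), `Sel n μ = eig μ ⊓ S n`; localisations `loc q : H → L q` with a line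
`Lfin q ≤ L q` and a sign `ε q`. Hypotheses: `2 ≠ 0` in `F`; the `S n` are finite-dimensional; (L) `dim Lfin q ≤ 1` and
`loc q (S n) ⊆ Lfin q` for `q ∉ n`; (P1) KERNEL DESCRIPTION: if `loc q` is non-trivial on `S n` (`q ∉ n`) then
`S (n ∪ {q}) = S n ⊓ ker (loc q)`; (P2) ČEBOTAREV: every non-zero `c ∈ Sel n μ` has `loc q c ≠ 0` for some `q ∉ n`;
(P3) `loc q ∘ τ = ε_q · loc q`. Conclusion: for every non-zero `c ∈ Sel n μ` there is `q ∉ n` with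
`c ∉ Sel (n∪{q}) μ`, `Sel (n∪{q}) μ ≤ Sel n μ` of codimension EXACTLY one, and `Sel (n∪{q}) (−μ) = Sel n (−μ)` —
verbatim the shape `hA1` of `exists_ne_zero_of_zhangInduction`. Proof: (P2) gives `q`; its sign is forced to be `μ`
(`sign_eq_of_loc_ne_zero`), so `loc q` kills `eig (−μ)` and the `−μ`-part of the kernel description (P1) is all of
`Sel n (−μ)`; the `μ`-part is `Sel n μ ⊓ ker`, of codimension one by rank–nullity against the line (L).
[cite: WZhang2014, Prop. 5.4, Lemma 7.3, §9 (9.1)–(9.2)] [cite: BertoliniDarmon2005, Lemma 2.6, Thm. 3.2] -/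
theorem rankLowering_of_lineDichotomy
    (S : Finset Q → Submodule F H) (eig : Bool → Submodule F H) (Sel : Finset Q → Bool → Submodule F H)
    (τ : H →ₗ[F] H) (loc : ∀ q : Q, H →ₗ[F] L q) (Lfin : ∀ q : Q, Submodule F (L q)) (ε : Q → Bool)
    (h2 : (2 : F) ≠ 0)
    (hSel : ∀ (n : Finset Q) (μ : Bool), Sel n μ = eig μ ⊓ S n)
    (heig : ∀ (μ : Bool) (x : H), x ∈ eig μ → τ x = if μ then x else -x)
    (hfinS : ∀ n : Finset Q, FiniteDimensional F (S n))
    -- (L) the finite part at `q` is a line receiving the classes unramified at `q`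
    (hfinL : ∀ q : Q, FiniteDimensional F (Lfin q))
    (hline : ∀ q : Q, finrank F (Lfin q) ≤ 1)
    (hmem : ∀ (n : Finset Q) (q : Q), q ∉ n → ∀ x ∈ S n, loc q x ∈ Lfin q)
    -- (P1) kernel description at a prime where `loc q` is non-trivial on `S n`
    (hker : ∀ (n : Finset Q) (q : Q), q ∉ n → (∃ c ∈ S n, loc q c ≠ 0) →
      S (insert q n) = S n ⊓ LinearMap.ker (loc q))
    -- (P2) Čebotarev: a non-zero eigenclass is detected at some new admissible prime
    (hcheb : ∀ (n : Finset Q) (μ : Bool) (c : H), c ∈ Sel n μ → c ≠ 0 → ∃ q, q ∉ n ∧ loc q c ≠ 0)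
    -- (P3) τ-equivariance with a scalar local sign
    (hequiv : ∀ (q : Q) (x : H), loc q (τ x) = if ε q then loc q x else -loc q x) :
    ∀ (n : Finset Q) (μ : Bool) (c : H), c ∈ Sel n μ → c ≠ 0 →
      ∃ q, q ∉ n ∧ c ∉ Sel (insert q n) μ ∧ Sel (insert q n) μ ≤ Sel n μ ∧
        finrank F (Sel (insert q n) μ) + 1 = finrank F (Sel n μ) ∧ Sel (insert q n) (!μ) = Sel n (!μ) := by
  intro n μ c hc hc0
  obtain ⟨q, hqn, hqc⟩ := hcheb n μ c hc hc0
  have hc' : c ∈ eig μ ⊓ S n := hSel n μ ▸ hc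
  obtain ⟨hceig, hcS⟩ := Submodule.mem_inf.mp hc'
  -- the sign of `q` is forced to be `μ`
  have hsign : ε q = μ := sign_eq_of_loc_ne_zero eig τ (loc q) (ε q) h2 heig (hequiv q) hceig hqc
  -- (P1): kernel description of the raised level
  have hS : S (insert q n) = S n ⊓ LinearMap.ker (loc q) := hker n q hqn ⟨c, hcS, hqc⟩
  have hSelq : ∀ ν : Bool, Sel (insert q n) ν = Sel n ν ⊓ LinearMap.ker (loc q) := fun ν ↦ by
    rw [hSel, hSel, hS, inf_assoc]
  refine ⟨q, hqn, ?_, ?_, ?_, ?_⟩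
  · -- `c` is killed
    intro hcq
    rw [hSelq] at hcq
    exact hqc (LinearMap.mem_ker.mp (Submodule.mem_inf.mp hcq).2)
  · -- inclusion
    rw [hSelq]
    exact inf_le_left
  · -- codimension exactly one: rank–nullity against the line `Lfin q`
    haveI : FiniteDimensional F (Sel n μ) := by
      rw [hSel]
      haveI := hfinS n
      exact Submodule.finiteDimensional_of_le inf_le_right
    haveI := hfinL q
    rw [hSelq]
    refine finrank_inf_ker_add_one_of_line (Sel n μ) (loc q) (Lfin q) (hline q) ?_ ⟨c, hc, hqc⟩
    intro x hx
    rw [hSel] at hx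
    exact hmem n q hqn x (Submodule.mem_inf.mp hx).2
  · -- the `−μ`-eigenspace is untouched: `loc q` kills it
    rw [hSelq]
    refine le_antisymm inf_le_left (le_inf le_rfl fun x hx ↦ ?_)
    rw [hSel] at hx
    have hxe : x ∈ eig (!μ) := (Submodule.mem_inf.mp hx).1
    have hne : ε q ≠ !μ := by rw [hsign]; cases μ <;> decide
    exact LinearMap.mem_ker.mpr (loc_eq_zero_of_mem_eig_of_sign_ne eig τ (loc q) (ε q) h2 heig (hequiv q) hxe hne)

end Summit.BirchSwinnertonDyer.Rank1Residual.X11b.Three.Koly.ZhangInduction
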